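import Literature.NumberTheory.EllipticCurves.Kobayashi2003.EtaColemanPoitouTateSequences
import Literature.NumberTheory.EllipticCurves.Kato2004.AdmissibleZetaClass
import HarnessLib

/-!
# Kobayashi 2003, §8.5–§8.7 (Cor. 8.20, Prop. 8.25 with (8.29), Prop. 8.26): the interpolation law of the
# EVEN Coleman map AS A MAP, read on the pinned `η`-twisted objects — ONE predicate
# (`ColPlusInterpolation`) and ONE existence fact (`exists_colPlusInterpolation`)

Topic `NumberTheory/EllipticCurves`, sub-directory `Kobayashi2003` (namespace = path).  Cell `bsd-cm`, seat
`bsd-cm-k-ty1` g38 (literature-prover), on the PLACEMENT of the `bsd-eis` desk (host g43, 2026-08-31: «COMPOSITION;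
the one typable print display is [A] = the interpolation law of `Col⁺` as a map», form (β)), director-bsd (956)(a),
pen bsd-cm-plan D1195/D1196 (junction conditions (J1)/(J2)), critic idea-crit-15 NOTE #54 (cert conditions (c1)–(c6)).
Consumer: crux item stmt-BirchSwinnertonDyer-19223 `CccOneLawOnTypeIstarZero`, registered stub 2c-T1
`stub_zetaLinesProportionalIstarZero` of `Cruxes/CccOneLawOnTypeIstarZero/Lines/kato_perrin_riou_istar.lean` (v15), whose
Theorems-side closer takes `(hA : exists_colPlusInterpolation)` as a HYPOTHESIS.  HONEST FRAMING: nothing about any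
curve's Birch–Swinnerton-Dyer formula follows from this file; it vendors ONE printed display as a named fact
(`def … : Prop`, nothing asserted, no `_holds`; net named-fact debt +1) and a predicate with a body.  No `instance`, no
`notation`, no attribute is declared or removed; the landed structure `EtaColemanPoitouTateData` is NOT modified.

## Source (held text `paper:doi-10-1007-s00222-002-0265-4`, PDF page:line)

S. Kobayashi, *Iwasawa theory for elliptic curves at supersingular primes*, Invent. Math. 152 (2003) 1–36, for
`E/ℚ` with good supersingular reduction at `p ≥ 3`… (here `a_p = 0`), `k_n = ℚ_p(ζ_{p^{n+1}})`, `G_n = Gal(k_n/ℚ_p)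
= Gal(ℚ(ζ_{p^{n+1}})/ℚ)`, `Λ_n = ℤ_p[G_n] = ℤ_p[Δ][X]/(ω_n(X))`, `γ_n ↦ 1 + X` (p. 20 L33–35):
* §8.5 and Prop. 8.25 (p. 24 L60–65): for `x ∈ Ê(m_n)` the morphism `P_{n,x} : H¹(k_n, T) → Λ_n` «is described in
  terms of the dual exponential map as follows: `P_{n,x}(z) = Σ_{σ∈G_n} (x^σ, z)_n σ`», with (8.29) (p. 24 L49–58)
  «`(x, z)_n = Tr_{k_n/ℚ_p} log_Ê(x) exp*_{ω_E}(z)` for every `x ∈ Ê(m_n)` and `z ∈ H¹(k_n, V)`».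
* `P_n^± := P_{n, c_n^±}` (p. 20 L5), `ω_n^±` (8.24) (p. 20 L22–30; the tree's `cyclotomicOmegaPlus/Minus`), and
  Cor. 8.20 (p. 21 L54–64): «There exists a unique morphism `Col_n^±` which makes the following diagram commutative»
  — `P_n^± = (× ω_n^∓) ∘ Col_n^±`; in the words of the proof of Thm. 6.3 (p. 25 L64–66): «by Corollary 8.20, we have
  `ψ ∘ P_n^+ = ω_n^−(ζ − 1) π_ψ ∘ Col_n^+` where `χ(γ_n) = ζ` and `π_ψ : Λ_n → ℚ̄_p`, `X ↦ ζ − 1`».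
* Prop. 8.26 (p. 25 L5–20): for `ψ` a character of `G_n` of conductor `p^{m+1}`,
  `p^{−[(n+1)/2]} Σ_{σ∈G_n} log(c_n^+)^σ ψ(σ) = (−1)^{(m+2)/2} p^{−[(m+1)/2]} τ(ψ)` if `m` is even, `= 0` if `m` is odd
  (and the odd-sign twin), «Here `τ(ψ)` is the Gauss sum `Σ_{σ∈G_m} ψ(σ) ζ_{p^{m+1}}^σ`» (p. 25 L40–44).
* Proof of Thm. 6.3 (p. 25 L61–70): «It suffices to show that `Col^±(z^{η(−1)})^{ε_η}` has interpolation properties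
  (3.4) and (3.5). … Hence by Proposition 8.25, 8.26 and Theorem 5.2 …» — the print APPLIES the chain to Kato's
  element only; the chain itself (Cor. 8.20 ∘ Prop. 8.25 ∘ (8.29) ∘ Prop. 8.26) is displayed for EVERY `z`.

COMPOSITION OF THE DISPLAYS, for `z ∈ H¹(k_n, T)` and `ψ` of conductor EXACTLY `p^{n+1}` (`m = n`, `n` even):
`ψ(P_n^+ z) = Σ_σ ψ(σ) (c^σ, z)_n = Σ_σ ψ(σ) Σ_{τ∈G_n} log(c^{στ})·τ(exp*_{ω_E} z) = (Σ_ρ ψ(ρ) log c^ρ) · Σ_τ ψ(τ)⁻¹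
τ(exp*_{ω_E} z) = (−1)^{(n+2)/2} τ(ψ) · Σ_τ ψ(τ)⁻¹ exp*_{ω_E}(z^τ)` (the powers `p^{−[(n+1)/2]}` of Prop. 8.26 CANCEL
at `m = n`; `log` and `exp*` are `G_n`-equivariant), hence
  `ψ(Col_n^+ z) · ω_n^−(ζ − 1) = (−1)^{n/2+1} · τ(ψ) · Σ_{τ∈G_n} ψ⁻¹(τ) · exp*_{ω_E}(z^τ)`.            (§8.7-law)

## What is typed, and in which currency (reading flag `Kob03-eta-twist-currency`, as the sibling files)

The tree's Kobayashi package `EtaColemanPoitouTateData p K₀ η V f ϖ κ γ W I FB` (sibling file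
`EtaColemanPoitouTateSequences`) is stated on the `η`-TWISTED curve `W` (`C • W^{(p*)} = V`, `T_pW = T_pV ⊗ η`) and its
pinned Iwasawa cohomology `I : Kato2004.IwasawaH1Data W p κ γ` («`𝐇¹(T_pV)^η = 𝐇¹_Γ(T_pW)`»); its field
`colPlus : I.H →ₗ[Λ] Λ` is «`Col⁺ ∘ loc_𝔭` on the `η`-component», ABSTRACT (pinned only at `z` by `isPlus_colPlus_z`).
This file states (§8.7-law) for `P.colPlus` and EVERY `z : I.H`, read on `W`:
* the value `ψ(P.colPlus z)` is the sum of the power series `P.colPlus z ∈ ℤ_p⟦X⟧` at `X = ζ − 1`, `ζ = ψ(1+p)`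
  (`cyclotomicGenerator`), EXACTLY as in `IsQuadraticBranchPlusLFunction` (the tree's reading of (3.4));
* the dual-exponential values of the layer class `I.proj n z ∈ H¹(ℚ_n, T_pW)` are read through an exp*-DATUM
  `(d, ι, κK, Λ)` with `Kato2004.DefinedExpStarBody W p f_W d ι κK Λ` (sibling `Kato2004/EulerSystemDefinedValues`:
  `Λ_{k,r} = exp*_d ∘ loc_p : H¹(ℚ(μ_m), T_pW) → ℚ_p ⊗ ℚ(ζ_m)` semi-locally, `Gal(ℚ(μ_m)/ℚ)`-equivariant) — the SAME
  currency the admissibility predicate `Kato2004.IsAdmissibleZetaClass` quantifies over (`AdmissibleZetaClassBody`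
  (A1)–(A4)); the layer class is restricted to the level `ℚ(μ_{p^{n+1}}) ⊇ ℚ_n` along the tree's
  `ZpExtension.IsCyclotomic.cyclotomicLevelsRat_level_succ_le_layerSubgroup` (`p` odd) and read into `ℂ_p` by
  `padicCharSum` (the `p`-adic twin of `Kato2004.EulerSystemValues.charSum`) through `p`-adic embeddings `ιp`;
* CURRENCY POINT (desk/critic (c3)): on `W` the Galois element `τ ∈ G_n` acts on the `η`-component class with the extra
  sign `η(τ)` (`T_pV = T_pW ⊗ η`), so the `W`-side character in the exp*-sum is `ψ⁻¹·η = ψ^{p^n − 1}` (for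
  `orderOf ψ = 2p^n`, `p` odd, `ψ^{p^n} = η` is THE quadratic character mod `p^{n+1}`); the evaluation point
  `ζ = ψ(1+p) = (ψη)(1+p)` is unchanged;
* form (β) (desk ruling): ONE global scalar `λ ≠ 0` — bound AFTER the exp*-datum and the embeddings, BEFORE `z, n, ψ`
  — absorbs the `η`-twist transport scalar (`ω_V ↔ ω_W`, `exp*_{ω_V} ↔ exp*_d` over `ℚ_p(√p*)`; NOT printed at a prime
  dividing the twisting conductor: KERNEL duty [C] of the consumer, never in this fact) and Kobayashi's `ℤ_pˣ`-normalisations;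
  the `p`-adic embeddings of the levels `ℚ(ζ_{p^{n+1}})` are taken COHERENT on `ℚ(ζ_p)` (hypothesis (COH): the images of
  `ζ_{p^{n+1}}^{p^n}` agree) — WEAKER than quantifying over all embeddings (the law with one global `λ` is covariant only
  under a simultaneous relabelling `ιp ↦ ιp ∘ σ_a`, which multiplies the right side by `η(a)`; the scalar `√p* ∈ ℚ(ζ_p)`).
Everything recorded is implied by, never stronger than, the print read through the flag; the existence fact quantifies
`∃ P` (pen (J1), critic (c2)): an ARBITRARY inhabitant of the hypothesis structure need not interpolate, so NO `∀ P` law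
is stated.  Non-vacuity: the frame is inhabited by `thm62_63_73_etaColemanPoitouTate` (print), the exp*-antecedent by
`Kato2004.exists_eulerSystem_definedExpStar_values` (print), (COH)-coherent embeddings exist (choose `ιp` level by level).

## What is NOT here (and why)

* NO value of `λ`, no `v_p(λ)`, no `ψ`-independence proof of the twist bookkeeping — [C] is kernel duty (desk ruling);
  NO «`a = b`» (stub 2c-T2, research); NO (VAL) (stub 1b′, research); NO odd-sign (`Col⁻`) twin (not consumed by 2c-T1;
  TODO(general form): the `−` law with `ω_n^+`, `n` odd, and the local objects `H¹_Iw(k_∞, T)` of Def. 6.1/§8 —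
  flag `Kob03-721-eta-maps-existential` of the sibling file).
* NO new field on `EtaColemanPoitouTateData`, no instance, no notation, no `_holds` (Honda theory §8 is not in Mathlib).

References: [Kobayashi2003] §8.5 (p. 20), Cor. 8.20 (p. 21), (8.24) (p. 20), Prop. 8.25 and (8.29) (p. 24), Prop. 8.26
and the proof of Thm. 6.3 (p. 25), Thm. 6.2–6.3 (p. 11), (3.4) (p. 7); [Kato2004Asterisque] §12.2 (p. 220), Thm. 12.5 (1)
(p. 221), §9.4 (p. 188) (the semi-local `exp*`); [Rubin2000] App. B §2 (continuous cohomology of the levels).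
-/

noncomputable section

open scoped Classical TensorProduct NumberField

open CongruenceSubgroup Polynomial WeierstrassCurve Field IsDedekindDomain
  Literature.NumberTheory.EllipticCurves Literature.NumberTheory.EllipticCurves.ModularForms
  Literature.NumberTheory.GaloisRepresentations Literature.NumberTheory.EllipticCurves.Kato2004
  Literature.NumberTheory.EllipticCurves.Kato2004.EulerSystemValues ZpExtension

namespace Literature.NumberTheory.EllipticCurves.Kobayashi2003

/-! ## §1 `p`-adic read-off of the semi-local value space `ℚ_p ⊗ ℚ(ζ_m)` (twins of `EulerSystemValues.charSum`) -/

section PadicReading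

variable (p : ℕ) [Fact p.Prime]

/-- The `p`-adic READ-OFF `ℚ_p ⊗_ℚ ℚ(ζ_m) → ℂ_p`, `s ⊗ x ↦ s · ιp(σ_b x)`, through a `p`-adic embedding `ιp` of `ℚ(ζ_m)`
composed with `σ_b ∈ Gal(ℚ(ζ_m)/ℚ)` (`EulerSystemValues.sigma`, `σ_b ζ = ζ^b`): the `p`-adic twin of the summand
`ι(σ_b x)` of `EulerSystemValues.charSum`, extended `ℚ_p`-linearly to the semi-local value space of Kato's `exp*`
(Kato §9.4: `exp* : H¹(ℚ(ζ_m) ⊗ ℚ_p, V) → S(f) ⊗ F_λ ⊗ ℚ(ζ_m)`). A definition (Mathlib `Algebra.TensorProduct.lift`).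
[cite: Kato2004Asterisque, §9.4 (p. 188) and (5.7.1) (p. 157)] -/
def padicReadOff (m : ℕ) [NeZero m] (ιp : CyclotomicField m ℚ →+* ℂ_[p]) (b : (ZMod m)ˣ) :
    ℚ_[p] ⊗[ℚ] CyclotomicField m ℚ →ₐ[ℚ] ℂ_[p] :=
  Algebra.TensorProduct.lift (algebraMap ℚ_[p] ℂ_[p]).toRatAlgHom
    (ιp.toRatAlgHom.comp ((sigma m b).toAlgHom))
    (fun _ _ ↦ Commute.all _ _)

/-- The `p`-adic CHARACTER SUM `Σ_{b ∈ (ℤ/m)ˣ} θ(b) · (s ⊗ x ↦ s·ιp(σ_b x))(y)` of a semi-local value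
`y ∈ ℚ_p ⊗ ℚ(ζ_m)` against a `ℂ_p`-valued Dirichlet character `θ` mod `m` — Kobayashi's `Σ_{σ∈G_n} θ(σ) · (exp* z)^σ`
read in `ℂ_p` (Prop. 8.25 with (8.29)); twin of `EulerSystemValues.charSum`. A definition.
[cite: Kobayashi2003, Prop. 8.25 and (8.29) (p. 24)] -/
def padicCharSum (m : ℕ) [NeZero m] (ιp : CyclotomicField m ℚ →+* ℂ_[p]) (θ : DirichletCharacter ℂ_[p] m)
    (y : ℚ_[p] ⊗[ℚ] CyclotomicField m ℚ) : ℂ_[p] :=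
  ∑ b : (ZMod m)ˣ, θ (b : ZMod m) * padicReadOff p m ιp b y

set_option backward.isDefEq.respectTransparency false in
/-- Kobayashi's GAUSS SUM `τ(θ) = Σ_{σ∈G_n} θ(σ) ζ_m^σ = Σ_{b ∈ (ℤ/m)ˣ} θ(b) ιp(ζ_m)^b` of a `ℂ_p`-valued Dirichlet
character mod `m`, read through the `p`-adic embedding `ιp` (`ζ_m = zeta m ℚ ℚ(ζ_m)`, `σ_b ζ_m = ζ_m^b` by
`EulerSystemValues.sigma_apply_zeta`). A definition. [cite: Kobayashi2003, Prop. 8.26 (p. 25, «Here τ(ψ) is the Gauss sum»)] -/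
def padicGaussSum (m : ℕ) [NeZero m] (ιp : CyclotomicField m ℚ →+* ℂ_[p]) (θ : DirichletCharacter ℂ_[p] m) : ℂ_[p] :=
  ∑ b : (ZMod m)ˣ, θ (b : ZMod m) * ιp (IsCyclotomicExtension.zeta m ℚ (CyclotomicField m ℚ)) ^ (b : ZMod m).val

/-- Unfolding `padicCharSum`. [cite: Kobayashi2003, Prop. 8.25 (p. 24)] -/
theorem padicCharSum_def (m : ℕ) [NeZero m] (ιp : CyclotomicField m ℚ →+* ℂ_[p])
    (θ : DirichletCharacter ℂ_[p] m) (y : ℚ_[p] ⊗[ℚ] CyclotomicField m ℚ) :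
    padicCharSum p m ιp θ y = ∑ b : (ZMod m)ˣ, θ (b : ZMod m) * padicReadOff p m ιp b y :=
  rfl

set_option backward.isDefEq.respectTransparency false in
/-- Unfolding `padicGaussSum`. [cite: Kobayashi2003, Prop. 8.26 (p. 25)] -/
theorem padicGaussSum_def (m : ℕ) [NeZero m] (ιp : CyclotomicField m ℚ →+* ℂ_[p])
    (θ : DirichletCharacter ℂ_[p] m) :
    padicGaussSum p m ιp θ =
      ∑ b : (ZMod m)ˣ, θ (b : ZMod m) * ιp (IsCyclotomicExtension.zeta m ℚ (CyclotomicField m ℚ)) ^ (b : ZMod m).val :=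
  rfl

/-- The read-off on pure tensors: `padicReadOff (s ⊗ x) = s · ιp(σ_b x)`. [cite: Kato2004Asterisque, §9.4 (p. 188)] -/
theorem padicReadOff_tmul (m : ℕ) [NeZero m] (ιp : CyclotomicField m ℚ →+* ℂ_[p]) (b : (ZMod m)ˣ)
    (s : ℚ_[p]) (x : CyclotomicField m ℚ) :
    padicReadOff p m ιp b (s ⊗ₜ[ℚ] x) = algebraMap ℚ_[p] ℂ_[p] s * ιp (sigma m b x) := by
  simp [padicReadOff, Algebra.TensorProduct.lift_tmul]

end PadicReading

/-! ## §2 The predicate: (§8.7-law) for the pinned package `P`, every `z : I.H`, every even `n`, every `ψ` of order `2pⁿ` -/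

section Law

variable (p : ℕ) [Fact p.Prime] {K₀ : Type} [Field K₀] [NumberField K₀] [(galRange (K := ℚ) K₀).Normal]
  {η : absoluteGaloisGroup ℚ →* ℤˣ} {V : WeierstrassCurve ℚ} [V.IsElliptic] {N : ℕ} {f : CuspForm (Gamma0 N) 2}
  {ϖ : ℚ} {κ : ZpExtension ℚ p} {γ : absoluteGaloisGroup ℚ}
  {W : WeierstrassCurve ℚ} [W.IsElliptic] [ContinuousSMul ℤ_[p] (W.tateModule p)]
  [Module.Free ℤ_[p] (W.tateModule p)] [Module.Finite ℤ_[p] (W.tateModule p)]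
  {I : Kato2004.IwasawaH1Data W p κ γ} {FB : W.FineSelmerDualData κ γ}

set_option backward.isDefEq.respectTransparency false in
/-- **`ColPlusInterpolation p hκ hp P` — Kobayashi's interpolation law of the EVEN Coleman map AS A MAP (Cor. 8.20 ∘
Prop. 8.25 ∘ (8.29) ∘ Prop. 8.26, module docstring (§8.7-law)), for the pinned package `P : EtaColemanPoitouTateData …`
on the `η`-twisted objects, in form (β).**  For every exp*-datum `(f_W, d, ι, κK, Λ)` of `W` with
`Kato2004.DefinedExpStarBody W p f_W d ι κK Λ` and every family of `p`-adic embeddings `ιp_m : ℚ(ζ_m) → ℂ_p` COHERENT on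
`ℚ(ζ_p)` along the `p`-power levels ((COH): `ιp(ζ_{m_n})^{p^n} = ιp(ζ_{m_0})`, `m_n = cycLevel p (n+1) ∅ = p^{n+1}`),
there is ONE scalar `λ ∈ ℂ_p`, `λ ≠ 0`, such that for every `z : I.H`, every EVEN `n` and every Dirichlet character
`ψ` mod `p^{n+1}` of order `2pⁿ` (`ψ = ηχ`), with `ζ = ψ(1+p)`:
`(P.colPlus z)(ζ − 1) = λ · (−1)^{n/2+1} · τ(ψ) / ω_n⁻(ζ − 1) · Σ_{b ∈ (ℤ/p^{n+1})ˣ} ψ(b)^{p^n − 1} · (ιp ∘ σ_b)(Λ_{n+1,∅}(res z_n))`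
— left side as the `HasSum` of `IsQuadraticBranchPlusLFunction`, `τ(ψ) = padicGaussSum`, `ω_n⁻ = cyclotomicOmegaMinus`,
`res z_n` = the restriction of the layer class `I.proj n z ∈ H¹(ℚ_n, T_pW)` to the level `ℚ(μ_{p^{n+1}})`
(`cyclotomicLevelsRat_level_succ_le_layerSubgroup`, `p` odd), `ψ^{p^n−1} = ψ⁻¹·η` the `W`-currency character
(flag `Kob03-eta-twist-currency`; module docstring «CURRENCY POINT»).  The instances `Module.Free/Finite ℤ_[p] (T_pW)`
are BINDERS as in `Kato2004.AdmissibleZetaClassBody`.  LEVEL `n = 0` INSTANCE (for the referee's tick; critic NOTE #55 (ii)):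
`ψ = η` (order `2`), `ζ = η(1+p) = 1`, `ω_0⁻ = 1` (`cyclotomicOmegaMinus_zero`; Kobayashi (8.24) `ω_0^± = 1`), `ψ^{p^0−1} = 1`,
so the law reads `(P.colPlus z)(0) = −λ · τ(η) · Σ_{b ∈ (ℤ/p)ˣ} (ιp ∘ σ_b)(Λ_{1,∅}(res z_0))` (a trace) — Prop. 8.26 at
`m = n = 0` (`(−1)^{(0+2)/2} = −1`, `p^0`) with Cor. 8.20 at `n = 0`.  A predicate; nothing asserted; existence for SOME
package is the named fact `exists_colPlusInterpolation`.
[cite: Kobayashi2003, Cor. 8.20 (p. 21), Prop. 8.25 and (8.29) (p. 24), Prop. 8.26 and proof of Thm. 6.3 (p. 25)]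
[cite: Kato2004Asterisque, §9.4 (p. 188), §12.2 (p. 220)] -/
def ColPlusInterpolation (hκ : κ.IsCyclotomic) (hp : p ≠ 2)
    (P : EtaColemanPoitouTateData p K₀ η V f ϖ κ γ W I FB) : Prop :=
  ∀ {N' : ℕ} [NeZero N'] (f' : CuspForm (Gamma0 N') 2) (d : _) (ι : (m : ℕ) → (CyclotomicField m ℚ →+* ℂ))
    (κK : ℝ)
    (Λ : ∀ (k : ℕ) (r : Finset (HeightOneSpectrum (𝓞 ℚ))),
      H1 (tateRep W p) (cycSubgroup p k r) →ₗ[ℤ_[p]] ℚ_[p] ⊗[ℚ] CyclotomicField (cycLevel p k r) ℚ),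
    DefinedExpStarBody W p f' d ι κK Λ →
  ∀ (ιp : (m : ℕ) → (CyclotomicField m ℚ →+* ℂ_[p])),
    (∀ n : ℕ, ιp (cycLevel p (n + 1) ∅)
        (IsCyclotomicExtension.zeta (cycLevel p (n + 1) ∅) ℚ (CyclotomicField (cycLevel p (n + 1) ∅) ℚ)) ^ (p ^ n) =
      ιp (cycLevel p 1 ∅)
        (IsCyclotomicExtension.zeta (cycLevel p 1 ∅) ℚ (CyclotomicField (cycLevel p 1 ∅) ℚ))) →
  ∃ lam : ℂ_[p], lam ≠ 0 ∧
    ∀ (z : I.H) (n : ℕ), Even n →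
      ∀ ψ : DirichletCharacter ℂ_[p] (p ^ (n + 1)), orderOf ψ = 2 * p ^ n →
        HasSum
          (fun k : ℕ ↦ ((algebraMap ℚ_[p] ℂ_[p]).comp (algebraMap ℤ_[p] ℚ_[p]))
              (PowerSeries.coeff k (P.colPlus z)) *
            (ψ (cyclotomicGenerator p : ZMod (p ^ (n + 1))) - 1) ^ k)
          (lam *
            ((-1 : ℂ_[p]) ^ (n / 2 + 1) *
              padicGaussSum p (cycLevel p (n + 1) ∅) (ιp (cycLevel p (n + 1) ∅))
                (DirichletCharacter.changeLevel
                  (show p ^ (n + 1) ∣ cycLevel p (n + 1) ∅ from dvd_mul_right _ _) ψ) /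
              (cyclotomicOmegaMinus p n).eval₂ (algebraMap ℤ ℂ_[p])
                (ψ (cyclotomicGenerator p : ZMod (p ^ (n + 1))) - 1)) *
            padicCharSum p (cycLevel p (n + 1) ∅) (ιp (cycLevel p (n + 1) ∅))
              ((DirichletCharacter.changeLevel
                  (show p ^ (n + 1) ∣ cycLevel p (n + 1) ∅ from dvd_mul_right _ _) ψ) ^ (p ^ n - 1))
              (Λ (n + 1) ∅
                (resLe (tateRep W p).toTopRep (hκ.cyclotomicLevelsRat_level_succ_le_layerSubgroup hp ∅ n) 1
                  (I.proj n z))))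

end Law

/-! ## §3 The named fact: the package of Thm. 6.2/6.3/7.3 i)/Cor. 7.2 EXISTS TOGETHER WITH the §8.7 law -/

/-- **Kobayashi 2003, §8.5–§8.7 (Cor. 8.20, Prop. 8.25 with (8.29), Prop. 8.26) on top of Thm. 6.2 (6.13)/(6.15) +
Thm. 6.3 + Thm. 7.3 i) + Cor. 7.2 at the quadratic `η`, on pinned objects — EXISTENCE form (pen (J1), critic (c2)).**
For the frame of `thm62_63_73_etaColemanPoitouTate` VERBATIM (`p` odd, `K₀ = ℚ(μ_p)`, `η` trivial on `Gal(ℚ̄/K₀)` and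
`≠ 1`, `V/ℚ` globally minimal with good reduction at `p` and `a_p(V) = 0`, newform `f`, period ratio `ϖ`, cyclotomic
`κ` with generator `γ ∈ Gal(ℚ̄/K₀)` matching the cyclotomic variable, a model `W` of the twist `V^{(p*)}` with
`C • W.quadraticTwist p* = V`), every pinned `I : Kato2004.IwasawaH1Data W p κ γ` and `FB : W.FineSelmerDualData κ γ`:
there is a package `P : EtaColemanPoitouTateData p K₀ η V f ϖ κ γ W I FB` whose `colPlus` satisfies
`ColPlusInterpolation p hκ hp P` (§2; the `ℤ_p`-structure facts of `T_pW` supplied by the tree theorems, as in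
`Kato2004.IsAdmissibleZetaClass`).  Printed content: the package exists (Thm. 6.2/6.3/7.3 i)/Cor. 7.2 = sibling fact)
AND its `Col⁺` is THE even Coleman map of Cor. 8.20, whose values on every class are given by Prop. 8.25/(8.29)/8.26
(module docstring (§8.7-law)); read on `W = V ⊗ η` under the flag `Kob03-eta-twist-currency` with ONE global scalar
(form (β): weaker than print, never stronger).  Named fact (D-0014); nothing asserted; no `_holds` (Honda theory, §8).
Non-vacuity: frame = `thm62_63_73_etaColemanPoitouTate`, exp*-antecedent = `Kato2004.exists_eulerSystem_definedExpStar_values`.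
[cite: Kobayashi2003, Cor. 8.20 (p. 21), Prop. 8.25 and (8.29) (p. 24), Prop. 8.26 and proof of Thm. 6.3 (p. 25), Thm. 6.2–6.3 (p. 11), Thm. 7.3 i) and Cor. 7.2 (p. 13)]
[cite: Kato2004Asterisque, §9.4 (p. 188), §12.2 (p. 220), Thm. 12.4 (p. 221)] -/
def exists_colPlusInterpolation : Prop :=
  ∀ (p : ℕ) [Fact p.Prime] (K₀ : Type) [Field K₀] [NumberField K₀] [IsCyclotomicExtension {p} ℚ K₀]
    [(galRange (K := ℚ) K₀).Normal] (η : absoluteGaloisGroup ℚ →* ℤˣ),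
    (∀ σ ∈ galRange (K := ℚ) K₀, η σ = 1) → η ≠ 1 →
  ∀ (V : WeierstrassCurve ℚ) [V.IsElliptic] [V.IsGloballyMinimal] {N : ℕ} [NeZero N]
    {f : CuspForm (Gamma0 N) 2} (hp : p ≠ 2),
    V.HasGoodReductionAtPrime p → V.frobeniusTrace p = 0 → IsNewformOf V f →
  ∀ (ϖ : ℚ), (if Even (p / 2) then (ϖ : ℝ) * V.realPeriodRat = plusPeriod f
      else (ϖ : ℝ) * V.imaginaryPeriodRat = minusPeriod f) →
  ∀ (κ : ZpExtension ℚ p) (γ : absoluteGaloisGroup ℚ) (hκ : κ.IsCyclotomic),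
    κ.IsTopGenerator γ → γ ∈ galRange (K := ℚ) K₀ → IsCyclotomicVariable p γ →
  ∀ (W : WeierstrassCurve ℚ) [W.IsElliptic] [ContinuousSMul ℤ_[p] (W.tateModule p)]
    (C : VariableChange ℚ), C • W.quadraticTwist ((-1) ^ (p / 2) * p) = V →
  ∀ (I : Kato2004.IwasawaH1Data W p κ γ) (FB : W.FineSelmerDualData κ γ),
    ∃ P : EtaColemanPoitouTateData p K₀ η V f ϖ κ γ W I FB,
      letI : Module.Free ℤ_[p] (W.tateModule p) := W.module_free_tateModule_holds p
      letI : Module.Finite ℤ_[p] (W.tateModule p) := W.module_finite_tateModule_holds p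
      ColPlusInterpolation p hκ hp P

end Literature.NumberTheory.EllipticCurves.Kobayashi2003

end
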